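import Summits.ResolutionOfSingularities.ResolutionOfSingularities.Theorems.MarkedTransferCampaignW21TopDegreeLe
import HarnessLib

/-!
# [OURS · L1 W2.1] Case (III): the data lie in the Lucas class and the FIRST step `h♭(ε)` obeys the order bound

Rung L (rescue) of cell res-hironaka, RESCUE-SEED row L-G2, slot W2.1, seat res-L1-s21-pv-1. The Case-(III) order bound
`OrderBoundCaseIIIPos p` (vocabulary `MarkedTransferCampaignW21OrderBoundPos.lean`, res-L1-type-o3, p469452) concerns the
ITERATE `H♭_{III}(ε) = (h♭)^{k̄}(ε)`, `h♭(Z) = ∂^{(α+pβ)}Z · ∂^{(qγ₀)}Z` (row 057 `HFlat.pre`, `HFlat.caseIII`), with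
`k̄ = ⌊q/|α+pβ|⌋ + 1 ≥ 2` in Case (III) («0 < |α+pβ| ≤ |qγ₀| = q, |γ₀| = 1», row 056 `IsCaseIII`). It stays a CANDIDATE
(kill test K2.1's Case-(III) columns are its check of record). THIS FILE proves the part of it that the Case-(I) toolkit
of this seat settles, for every prime `p` and `e > 0`:

* `gamma_ne_zero_of_degree_le` — under `Standing`, if `|α+pβ| ≤ q` then NO top-block exponent `γ_j` is `0` (the term
  `u x^{α+pβ}` would be a term of `ε` of degree `≤ q < ord ε`: its monomial is met by no other term,
  `coeff_eq_constantCoeff_of_mem`, p475843);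
* `shortTopGamma_of_isCaseIII` — hence Case-(III) data lie in `ShortTopGamma ⊆ LucasClass` (`|γ₀| = 1 ≤ |γ_j|`,
  `q|γ₀| = q ≤ ord ε`);
* `orderBound_pre_of_isCaseIII` — and the FIRST step obeys the bound: `ord ε ≤ ord h♭(ε)` (`HFlat.pre` at `∂ = hasseD`),
  by the quantitative Lucas bound (`exists_gamma_le_order_hasseDeriv` + `order_le_order_hasseDeriv_add_degree`,
  p473059), which needs no case hypothesis.
The iterates `k ≥ 2` are NOT treated here (the products' terms are no longer a standard expression of the same shape).
Everything here is OURS / folklore; nothing is a statement of or about the manuscript under adjudication (GAP row R05);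
AI-produced formalisation, expert review is stronger than AI review.
-/

noncomputable section

set_option linter.dupNamespace false -- mandated namespace of this single-conjunct summit

namespace Summit.ResolutionOfSingularities.ResolutionOfSingularities.Theorems

namespace CampaignW21

open Literature.AlgebraicGeometry.Hironaka2017.S08UnitMonomial
open Literature.AlgebraicGeometry.Hironaka2017.S09LLUED
open Literature.AlgebraicGeometry.Hironaka2017.S09LLUED.TopFrontier
open Literature.AlgebraicGeometry.Resolution
open Literature.RingTheory.MvPowerSeries
open MvPowerSeries Finsupp

variable (p : ℕ) [hp : Fact p.Prime] {K : Type} [Field K] [CharP K p] {n e ℓ : ℕ}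

/-- **No top-block exponent vanishes when `|α+pβ| ≤ q`** (`Standing`, `0 < e`): if `γ_j = 0` the top-block term
`u_j x^{α+pβ}` is a term of `ε` whose monomial no other term meets (`coeff_eq_constantCoeff_of_mem`; its degree
`|α+pβ| ≤ |α+pβ+qγ₀| < p^ℓ`), so `ord ε ≤ |α+pβ| ≤ q`, contradicting `q < ord ε`. [folklore] -/
theorem gamma_ne_zero_of_degree_le (he : 0 < e) {ε : MvPowerSeries (Fin n) K}
    (S : StandardExpression p (xs K n) e ℓ ε) (h0 : 0 < frontierLength S.support S.u) (hS : Standing p e ℓ ε S h0)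
    (hX : (alpha S.support S.u + p • beta S.support S.u).degree ≤ p ^ e) (j : Fin (frontierLength S.support S.u)) :
    gamma S.support S.u j ≠ 0 := by
  intro hj
  have hjT : (alpha S.support S.u, beta S.support S.u, gamma S.support S.u j) ∈ S.support := gamma_mem j
  have hdepth : ((alpha S.support S.u, beta S.support S.u, gamma S.support S.u j).1 +
      p • (alpha S.support S.u, beta S.support S.u, gamma S.support S.u j).2.1 +
      p ^ e • (alpha S.support S.u, beta S.support S.u, gamma S.support S.u j).2.2).degree < p ^ ℓ := by
    show (alpha S.support S.u + p • beta S.support S.u + p ^ e • gamma S.support S.u j).degree < p ^ ℓ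
    rw [hj, smul_zero, add_zero]
    exact lt_of_le_of_lt (Finsupp.degree_mono le_self_add) hS.depth
  have hcoeff := coeff_eq_constantCoeff_of_mem p he S hjT hdepth
  have hne : coeff (alpha S.support S.u + p • beta S.support S.u + p ^ e • gamma S.support S.u j) ε ≠ 0 := by
    rw [show coeff (alpha S.support S.u + p • beta S.support S.u + p ^ e • gamma S.support S.u j) ε =
      constantCoeff (S.u (alpha S.support S.u, beta S.support S.u, gamma S.support S.u j)) from hcoeff]
    exact (isUnit_constantCoeff _ ((S.u_unit_or_zero _ hjT).resolve_right (u_gamma_ne_zero j))).ne_zero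
  have hle : adicOrder ε ≤ ((alpha S.support S.u + p • beta S.support S.u).degree : ℕ∞) := by
    rw [adicOrder_eq_order]
    have := MvPowerSeries.order_le hne
    rwa [hj, smul_zero, add_zero] at this
  have hlt := hS.ord_lt
  have : ((p ^ e : ℕ) : ℕ∞) < ((alpha S.support S.u + p • beta S.support S.u).degree : ℕ∞) := lt_of_lt_of_le hlt hle
  exact absurd (Nat.cast_lt.mp this) (not_lt.mpr hX)

/-- **Case-(III) data lie in `ShortTopGamma`** (`Standing`, `0 < e`): `|γ₀| = 1 ≤ |γ_j|` for every `j` (no `γ_j` is `0`,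
by `gamma_ne_zero_of_degree_le` with `|α+pβ| ≤ |qγ₀| = q`) and `q|γ₀| = q ≤ ord ε`. Hence they lie in `LucasClass`.
[folklore] -/
theorem shortTopGamma_of_isCaseIII (he : 0 < e) {ε : MvPowerSeries (Fin n) K}
    (S : StandardExpression p (xs K n) e ℓ ε) (h0 : 0 < frontierLength S.support S.u) (hS : Standing p e ℓ ε S h0)
    (hIII : IsCaseIII p (p ^ e) (alpha S.support S.u) (beta S.support S.u) (gamma S.support S.u ⟨0, h0⟩)) :
    ShortTopGamma p e ε S := by
  obtain ⟨-, hXle, hq, hγ₀⟩ := hIII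
  have hX : (alpha S.support S.u + p • beta S.support S.u).degree ≤ p ^ e := hXle.trans hq.le
  intro h0'
  refine ⟨?_, fun j => ?_⟩
  · -- `q|γ₀| = q ≤ ord ε`
    have : (gamma S.support S.u ⟨0, h0'⟩).degree = 1 := hγ₀
    rw [this, mul_one]
    exact hS.ord_lt.le
  · have h1 : (gamma S.support S.u ⟨0, h0'⟩).degree = 1 := hγ₀
    rw [h1]
    have hne := gamma_ne_zero_of_degree_le p he S h0 hS hX j
    rw [Ne, ← Finsupp.degree_eq_zero_iff] at hne
    omega

/-- Case-(III) data lie in the Lucas class. [folklore] -/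
theorem lucasClass_of_isCaseIII (he : 0 < e) {ε : MvPowerSeries (Fin n) K}
    (S : StandardExpression p (xs K n) e ℓ ε) (h0 : 0 < frontierLength S.support S.u) (hS : Standing p e ℓ ε S h0)
    (hIII : IsCaseIII p (p ^ e) (alpha S.support S.u) (beta S.support S.u) (gamma S.support S.u ⟨0, h0⟩)) :
    LucasClass p e ε S :=
  Or.inr (shortTopGamma_of_isCaseIII p he S h0 hS hIII)

/-- **[OURS · L1 W2.1] The FIRST step of the Case-(III) operator obeys the order bound**: under `Standing`, `0 < e` and
Case (III) of Lem. 9.6, `ord ε ≤ ord h♭(ε)` for `h♭(ε) = ∂^{(α+pβ)}ε · ∂^{(qγ₀)}ε` (row 057 `HFlat.pre` at `∂ = hasseD`;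
the Case-(III) value is the ITERATE `(h♭)^{k̄}(ε)`, `k̄ ≥ 2`, which this file does NOT treat). From the quantitative
Lucas bound: `ord h♭(ε) ≥ q|γ_j| + (ord ε ∸ q|γ₀|) ≥ q + (ord ε − q) = ord ε`. NOT a statement of the manuscript;
`OrderBoundCaseIIIPos p` remains a CANDIDATE. [folklore] -/
theorem orderBound_pre_of_isCaseIII (he : 0 < e) {ε : MvPowerSeries (Fin n) K}
    (S : StandardExpression p (xs K n) e ℓ ε) (h0 : 0 < frontierLength S.support S.u) (hS : Standing p e ℓ ε S h0)
    (hIII : IsCaseIII p (p ^ e) (alpha S.support S.u) (beta S.support S.u) (gamma S.support S.u ⟨0, h0⟩)) :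
    adicOrder ε ≤ adicOrder (HFlat.pre (hasseD K n) p (p ^ e)
      (alpha S.support S.u) (beta S.support S.u) (gamma S.support S.u ⟨0, h0⟩) ε) := by
  obtain ⟨hq0, hmin⟩ := shortTopGamma_of_isCaseIII p he S h0 hS hIII h0
  have hX : ∀ s, (alpha S.support S.u + p • beta S.support S.u) s < p ^ ℓ := fun s =>
    lt_of_le_of_lt ((Finsupp.le_degree s _).trans (Finsupp.degree_mono le_self_add)) hS.depth
  obtain ⟨j, hA⟩ := exists_gamma_le_order_hasseDeriv p he S h0 hX
  have hB : adicOrder ε - ((p ^ e * (gamma S.support S.u ⟨0, h0⟩).degree : ℕ) : ℕ∞) ≤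
      (hasseDeriv (p ^ e • gamma S.support S.u ⟨0, h0⟩) ε).order := by
    rw [adicOrder_eq_order]
    have h := Literature.RingTheory.MvPowerSeries.order_le_order_hasseDeriv_add_degree
      (p ^ e • gamma S.support S.u ⟨0, h0⟩) ε
    rw [map_nsmul, smul_eq_mul] at h
    exact tsub_le_iff_right.mpr h
  show adicOrder ε ≤ adicOrder (hasseD K n (alpha S.support S.u + p • beta S.support S.u) ε *
    hasseD K n (p ^ e • gamma S.support S.u ⟨0, h0⟩) ε)
  rw [adicOrder_eq_order (hasseD K n (alpha S.support S.u + p • beta S.support S.u) ε *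
    hasseD K n (p ^ e • gamma S.support S.u ⟨0, h0⟩) ε)]
  refine enat_le_of_short hq0 (Nat.mul_le_mul_left _ (hmin j)) ?_
  exact (add_le_add hA hB).trans MvPowerSeries.le_order_mul

end CampaignW21

end Summit.ResolutionOfSingularities.ResolutionOfSingularities.Theorems

end
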